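import Summits.Ventures.HodgeRepro2.T7SupportFockBidegreeOneOne

/-!
# The bidegree-(1,1) part of the Fock polynomial ring: trace ⊕ traceless (support, seat p1)

Census item U2 of `route/t7/Line3/REPAIR-CENSUS.md` §C (L3-ARGUMENT §4a (a)), second half, on the (1,1)-space
`ofMatrix (M₃(ℂ))` of `T7SupportFockBidegreeOneOne`: the decomposition `trace ⊕ traceless`, its canonicity, and the
rule «the vector `w_{i₀,0} w_{i₁,1}` has a non-zero traceless component always and a non-zero trace component iff
`i₀ = i₁`». Everything is finite-dimensional linear algebra:

* `tracePart A = (tr A / 3) • 1`, `tracelessPart A = A − tracePart A`: `matAct_tracePart` (invariant under every unitary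
  `u`), `tracePart_matAct`, `tracelessPart_matAct` (equivariant), `trace_tracelessPart`, `tracePart_add_tracelessPart`;
* CANONICITY from the base's first fundamental theorem (`T5FockFFT.invariant_iff`): `invariant_ofMatrix_iff` — the
  `U(3)`-invariants of bidegree (1,1) are exactly the multiples of `Q` (`Q ^ n` is homogeneous of degree `2n`, so only the
  linear term of a polynomial in `Q` has bidegree (1,1)); hence (`decomposition_unique`) the decomposition
  «invariant + trace-zero» is unique and `tracePart` IS the projection onto the invariants along the traceless hyperplane,
  which contains no non-zero invariant (`eq_zero_of_trace_eq_zero_of_invariant`);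
* THE RULE — `tracePart_single_ne_zero_iff : tracePart (single i₀ i₁ 1) ≠ 0 ↔ i₀ = i₁` and
  `tracelessPart_single_ne_zero : tracelessPart (single i₀ i₁ 1) ≠ 0`, also in the polynomial form through `ofMatrix`;
  `X_mul_X_decomposition : w_{i₀,0} w_{i₁,1} = ([i₀ = i₁] / 3) • Q + ofMatrix (tracelessPart (single i₀ i₁ 1))`.

What stays in words (the census's own caveat): the identification of the base's variables with `(z_i; w̄_j)` and of
`unitaryAct` with the `U(3)`-action on the Fock model, and the link `ℓ_∞ ↔ this component`. Nothing about any period,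
(N) or (P). Blind lane: Mathlib + the HodgeRepro2 prefix only; no sorry; axioms ⊆ {propext, Classical.choice, Quot.sound}.
-/

namespace Summit.Ventures.HodgeRepro2.T7SupportFockTraceDecomposition

open MvPolynomial Matrix
open T5FockInvariants T5FockWeights T7SupportFockBidegreeOneOne
/-- The trace part of a coefficient matrix: `(tr A / 3) • 1`. -/
noncomputable def tracePart (A : Matrix (Fin 3) (Fin 3) ℂ) : Matrix (Fin 3) (Fin 3) ℂ := (A.trace / 3) • (1 : Matrix (Fin 3) (Fin 3) ℂ)

/-- The traceless part of a coefficient matrix: `A − tracePart A`. -/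
noncomputable def tracelessPart (A : Matrix (Fin 3) (Fin 3) ℂ) : Matrix (Fin 3) (Fin 3) ℂ := A - tracePart A

/-! ### The decomposition `trace ⊕ traceless` -/

/-- The trace of the trace part is the trace. -/
theorem trace_tracePart (A : Matrix (Fin 3) (Fin 3) ℂ) : (tracePart A).trace = A.trace := by
  simp only [tracePart, Matrix.trace_smul, Matrix.trace_one, Fintype.card_fin, smul_eq_mul]
  push_cast
  field_simp

/-- The traceless part has trace zero. -/
theorem trace_tracelessPart (A : Matrix (Fin 3) (Fin 3) ℂ) : (tracelessPart A).trace = 0 := by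
  rw [tracelessPart, Matrix.trace_sub, trace_tracePart, sub_self]

/-- `A = tracePart A + tracelessPart A`. -/
theorem tracePart_add_tracelessPart (A : Matrix (Fin 3) (Fin 3) ℂ) : tracePart A + tracelessPart A = A := by
  rw [tracelessPart, add_sub_cancel]

/-- The trace part is a multiple of the identity. -/
theorem tracePart_eq_smul_one (A : Matrix (Fin 3) (Fin 3) ℂ) : tracePart A = (A.trace / 3) • (1 : Matrix (Fin 3) (Fin 3) ℂ) :=
  rfl

/-- **The trace part is invariant** under every unitary `u`. -/
theorem matAct_tracePart {u : Matrix (Fin 3) (Fin 3) ℂ} (hu : u * uᴴ = 1) (A : Matrix (Fin 3) (Fin 3) ℂ) :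
    matAct u (tracePart A) = tracePart A := by
  rw [tracePart, matAct_smul, matAct_one hu]

/-- **The trace part is equivariant**: `tracePart (matAct u A) = tracePart A`. -/
theorem tracePart_matAct {u : Matrix (Fin 3) (Fin 3) ℂ} (hu : u * uᴴ = 1) (A : Matrix (Fin 3) (Fin 3) ℂ) :
    tracePart (matAct u A) = tracePart A := by
  rw [tracePart, tracePart, trace_matAct hu]

/-- **The traceless part is equivariant**: `tracelessPart (matAct u A) = matAct u (tracelessPart A)`. -/
theorem tracelessPart_matAct {u : Matrix (Fin 3) (Fin 3) ℂ} (hu : u * uᴴ = 1) (A : Matrix (Fin 3) (Fin 3) ℂ) :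
    tracelessPart (matAct u A) = matAct u (tracelessPart A) := by
  rw [tracelessPart, tracelessPart, matAct_sub, tracePart_matAct hu, matAct_tracePart hu]

/-- The trace part vanishes iff the trace does. -/
theorem tracePart_eq_zero_iff (A : Matrix (Fin 3) (Fin 3) ℂ) : tracePart A = 0 ↔ A.trace = 0 := by
  rw [tracePart, smul_eq_zero, div_eq_zero_iff]
  simp

/-! ### Canonicity: the invariants of bidegree (1,1) are the multiples of `Q` (first fundamental theorem) -/

/-- `Q` is homogeneous of degree `2`. -/
theorem isHomogeneous_Q : (Q : MvPolynomial Var ℂ).IsHomogeneous 2 := by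
  unfold Q
  refine IsHomogeneous.sum _ _ _ fun i _ => ?_
  exact (isHomogeneous_X ℂ (i, 0)).mul (isHomogeneous_X ℂ (i, 1))

/-- The (1,1)-coefficients of `Q ^ n` vanish for `n ≠ 1`. -/
theorem coeff_Q_pow_eq_zero {n : ℕ} (hn : n ≠ 1) (i k : Fin 3) : coeff (e i k) ((Q : MvPolynomial Var ℂ) ^ n) = 0 := by
  refine (isHomogeneous_Q.pow n).coeff_eq_zero ?_
  rw [degree_e]
  omega

/-- The (1,1)-coefficients of a polynomial in `Q` come from the linear term. -/
theorem coeff_aeval_Q (P : Polynomial ℂ) (i k : Fin 3) :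
    coeff (e i k) (Polynomial.aeval (Q : MvPolynomial Var ℂ) P) = P.coeff 1 * (if i = k then 1 else 0) := by
  rw [Polynomial.aeval_eq_sum_range, coeff_sum]
  simp only [coeff_smul, smul_eq_mul]
  rw [Finset.sum_eq_single 1]
  · rw [pow_one, coeff_Q]
  · intro n _ hn
    rw [coeff_Q_pow_eq_zero hn, mul_zero]
  · intro h
    have : P.natDegree < 1 := by
      simpa [Finset.mem_range] using h
    rw [Polynomial.coeff_eq_zero_of_natDegree_lt this, zero_mul]

/-- **The `U(3)`-invariants of bidegree (1,1) are exactly the multiples of `Q`** (from the base's first fundamental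
theorem `T5FockFFT.invariant_iff`): `ofMatrix A` is `unitaryAct`-invariant iff `A` is a scalar matrix. -/
theorem invariant_ofMatrix_iff (A : Matrix (Fin 3) (Fin 3) ℂ) :
    (∀ u : Matrix (Fin 3) (Fin 3) ℂ, u * uᴴ = 1 → unitaryAct u (ofMatrix A) = ofMatrix A) ↔
      ∃ c : ℂ, A = c • (1 : Matrix (Fin 3) (Fin 3) ℂ) := by
  constructor
  · intro hinv
    obtain ⟨P, hP⟩ := (T5FockFFT.invariant_iff (ofMatrix A)).mp hinv
    refine ⟨P.coeff 1, ?_⟩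
    ext i k
    rw [← coeff_ofMatrix A i k, hP, coeff_aeval_Q, Matrix.smul_apply, Matrix.one_apply, smul_eq_mul]
  · rintro ⟨c, rfl⟩ u hu
    rw [unitaryAct_ofMatrix, matAct_smul, matAct_one hu]

/-- The traceless hyperplane contains no non-zero invariant. -/
theorem eq_zero_of_trace_eq_zero_of_invariant {A : Matrix (Fin 3) (Fin 3) ℂ} (hA : A.trace = 0)
    (hinv : ∀ u : Matrix (Fin 3) (Fin 3) ℂ, u * uᴴ = 1 → unitaryAct u (ofMatrix A) = ofMatrix A) : A = 0 := by
  obtain ⟨c, rfl⟩ := (invariant_ofMatrix_iff A).mp hinv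
  have hc : c = 0 := by
    simp only [Matrix.trace_smul, Matrix.trace_one, Fintype.card_fin, smul_eq_mul] at hA
    have h3 : (↑(3 : ℕ) : ℂ) ≠ 0 := by norm_num
    exact (mul_eq_zero.mp hA).resolve_right h3
  rw [hc, zero_smul]

/-- **Uniqueness of the decomposition «invariant + trace-zero»**: if `A = B + C` with `B` invariant (in the (1,1)-space)
and `C` of trace zero, then `B = tracePart A` and `C = tracelessPart A`. -/
theorem decomposition_unique {A B C' : Matrix (Fin 3) (Fin 3) ℂ} (hABC : A = B + C')
    (hB : ∀ u : Matrix (Fin 3) (Fin 3) ℂ, u * uᴴ = 1 → unitaryAct u (ofMatrix B) = ofMatrix B) (hC : C'.trace = 0) :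
    B = tracePart A ∧ C' = tracelessPart A := by
  obtain ⟨c, rfl⟩ := (invariant_ofMatrix_iff B).mp hB
  have htr : A.trace = c * 3 := by
    rw [hABC, Matrix.trace_add, hC, add_zero, Matrix.trace_smul, Matrix.trace_one, Fintype.card_fin, smul_eq_mul]
    push_cast
    ring
  have hB' : c • (1 : Matrix (Fin 3) (Fin 3) ℂ) = tracePart A := by
    rw [tracePart, htr]
    congr 1
    field_simp
  refine ⟨hB', ?_⟩
  rw [tracelessPart, ← hB', hABC, add_sub_cancel_left]

/-! ### The rule: `w_{i₀,0} w_{i₁,1}` has a non-zero trace part iff `i₀ = i₁`, and a non-zero traceless part always -/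

/-- The trace of an elementary matrix. -/
theorem trace_single (i j : Fin 3) (c : ℂ) : (single i j c).trace = if i = j then c else 0 := by
  simp only [Matrix.trace, Matrix.diag_apply, single_apply]
  by_cases h : i = j
  · subst h
    simp
  · rw [if_neg h]
    refine Finset.sum_eq_zero fun x _ => ?_
    rw [if_neg]
    rintro ⟨rfl, rfl⟩
    exact h rfl

/-- **The rule, trace half**: the trace part of `w_{i₀,0} w_{i₁,1}` is non-zero iff `i₀ = i₁`. -/
theorem tracePart_single_ne_zero_iff (i₀ i₁ : Fin 3) : tracePart (single i₀ i₁ (1 : ℂ)) ≠ 0 ↔ i₀ = i₁ := by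
  rw [Ne, tracePart_eq_zero_iff, trace_single]
  by_cases h : i₀ = i₁
  · simp [h]
  · simp [h]

/-- **The rule, traceless half**: the traceless part of `w_{i₀,0} w_{i₁,1}` is never zero. -/
theorem tracelessPart_single_ne_zero (i₀ i₁ : Fin 3) : tracelessPart (single i₀ i₁ (1 : ℂ)) ≠ 0 := by
  intro h
  rw [tracelessPart, sub_eq_zero] at h
  have h' := congrFun (congrFun h i₀) i₁
  rw [single_apply, tracePart_eq_smul_one, trace_single, Matrix.smul_apply, Matrix.one_apply, smul_eq_mul] at h'
  by_cases hi : i₀ = i₁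
  · simp only [hi, and_self, if_true] at h'
    norm_num at h'
  · simp [hi] at h'

/-- The polynomial form of the trace half: `ofMatrix (tracePart (single i₀ i₁ 1)) ≠ 0 ↔ i₀ = i₁`. -/
theorem ofMatrix_tracePart_single_ne_zero_iff (i₀ i₁ : Fin 3) :
    ofMatrix (tracePart (single i₀ i₁ (1 : ℂ))) ≠ 0 ↔ i₀ = i₁ := by
  rw [Ne, ofMatrix_eq_zero_iff]
  exact tracePart_single_ne_zero_iff i₀ i₁

/-- The polynomial form of the traceless half: `ofMatrix (tracelessPart (single i₀ i₁ 1)) ≠ 0`. -/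
theorem ofMatrix_tracelessPart_single_ne_zero (i₀ i₁ : Fin 3) :
    ofMatrix (tracelessPart (single i₀ i₁ (1 : ℂ))) ≠ 0 := by
  rw [Ne, ofMatrix_eq_zero_iff]
  exact tracelessPart_single_ne_zero i₀ i₁

/-- The trace part of `ofMatrix A` in the polynomial ring is `(tr A / 3) • Q`. -/
theorem ofMatrix_tracePart (A : Matrix (Fin 3) (Fin 3) ℂ) : ofMatrix (tracePart A) = (A.trace / 3) • Q := by
  rw [tracePart, ofMatrix_smul, ofMatrix_one]

/-- The polynomial decomposition: `w_{i₀,0} w_{i₁,1} = ([i₀ = i₁] / 3) • Q + ofMatrix (tracelessPart (single i₀ i₁ 1))`,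
with the trace summand invariant under every unitary `u` and the traceless summand of trace zero. -/
theorem X_mul_X_decomposition (i₀ i₁ : Fin 3) :
    (X (i₀, 0) * X (i₁, 1) : MvPolynomial Var ℂ) =
      ((if i₀ = i₁ then (1 : ℂ) else 0) / 3) • Q + ofMatrix (tracelessPart (single i₀ i₁ (1 : ℂ))) := by
  rw [← ofMatrix_single, ← trace_single i₀ i₁ (1 : ℂ), ← ofMatrix_tracePart, ← ofMatrix_add,
    tracePart_add_tracelessPart]

/-- The trace summand is invariant under every unitary `u`. -/
theorem unitaryAct_ofMatrix_tracePart {u : Matrix (Fin 3) (Fin 3) ℂ} (hu : u * uᴴ = 1) (A : Matrix (Fin 3) (Fin 3) ℂ) :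
    unitaryAct u (ofMatrix (tracePart A)) = ofMatrix (tracePart A) := by
  rw [unitaryAct_ofMatrix, matAct_tracePart hu]

/-- The traceless summand is carried to the traceless summand of the image. -/
theorem unitaryAct_ofMatrix_tracelessPart {u : Matrix (Fin 3) (Fin 3) ℂ} (hu : u * uᴴ = 1)
    (A : Matrix (Fin 3) (Fin 3) ℂ) :
    unitaryAct u (ofMatrix (tracelessPart A)) = ofMatrix (tracelessPart (matAct u A)) := by
  rw [unitaryAct_ofMatrix, tracelessPart_matAct hu]

end Summit.Ventures.HodgeRepro2.T7SupportFockTraceDecomposition
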